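import Summits.AtomisticToContinuum.BoseEinsteinCondensation.Theorems.BECGroundStateSOSPeriodicIRBoundDefs
import Summits.AtomisticToContinuum.BoseEinsteinCondensation.Theorems.BECGroundStateSOSPeriodicIRBoundWFDefs
import Summits.AtomisticToContinuum.BoseEinsteinCondensation.Theorems.BECGroundStateSOSPeriodicIRBoundWFPotToolkit
import Summits.AtomisticToContinuum.BoseEinsteinCondensation.Theorems.BECGroundStateSOSPeriodicIRBoundWFPotCross
import Summits.AtomisticToContinuum.BoseEinsteinCondensation.Theorems.BECGroundStateSOSPeriodicIRBoundWFFormBounds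
import Literature.MathematicalPhysics.QuantumManyBody.PeriodicBoseGasMomentumSector
import Literature.MathematicalPhysics.QuantumManyBody.TorusFockLayer
import Literature.MathematicalPhysics.QuantumManyBody.TorusFockSectorInteraction
import Literature.MathematicalPhysics.QuantumManyBody.PeriodicFormDomain
import Literature.MathematicalPhysics.QuantumManyBody.PeriodicBoseGasTagged
import Literature.MathematicalPhysics.QuantumManyBody.PeriodicBoseGasRelabelling
import Mathlib.MeasureTheory.Integral.Bochner.ContinuousLinearMap
import HarnessLib

/-! # Crux `PeriodicIRBound` (stmt-AtomisticToContinuum-3972), line `linear-ph-floor-wagner`, stub 5b `stub_wagnerFeynman` — PotCreate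
The potential of the particle state, part 1: `P[a_k†Φ]` as a double sum of pair integrals, symmetry reduction to `R₀₀ + (m+1)R₁₀`. -/

/-!

`(m+1)`-body `Φ`, `φ = planeWaveMode L k`, `a†Φ = modeCr φ Φ = (m+2)^{-1/2} ∑_j c_j`, `c_j(Z) = φ(Z j) Φ(Z without j)`
(`crTerm`) and the pair integrals `R_{jl} = ∫_{Λ^{m+2}} W.toReal conj(c_j) c_l` (`pairInt`):

* (1) `P[a†Φ].toReal = (m+2)⁻¹ Re ∑_{j,l} R_{jl}` (`toReal_potForm_modeCr_eq_sum`: `|∑ c_j|² = Re ∑ conj(c_j) c_l`,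
  finiteness P-d, integrability of every term against `W.toReal ∈ L¹(Λ^{m+2})`);
* (2) relabelling symmetry `R_{σj,σl} = R_{jl}` (`pairInt_perm`: TK2, `periodicInteraction_comp_perm`, Bose symmetry;
  `c_j(Z ∘ σ) = c_{σj}(Z)`), whence `R_{jj} = R_{00}`, `R_{jl} = R_{10}` (`j ≠ l`) and
  `∑_{j,l} R_{jl} = (m+2)(R_{00} + (m+1) R_{10})` (`sum_sum_pairInt`);
* (3a) `Re R_{00} = (∫ W |φ(Z 0)|² |Φ(tail Z)|²).toReal` (`re_pairInt_zero_zero`, the `ℝ≥0∞` integral of P-dir);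

combined in `toReal_potForm_modeCr_reduce`: `P[a†Φ].toReal = (∫ W|φ(Z 0)|²|Φ(tail Z)|²).toReal + (m+1) Re R_{10}`.
Part 2 (`WFPotCreate2.lean`) computes the pieces of `R_{10}`; part 3 (`WFPotCreate3.lean`) assembles P-b.
-/

noncomputable section

open scoped BigOperators ENNReal ComplexConjugate
open Filter MeasureTheory

namespace Summit.AtomisticToContinuum.BoseEinsteinCondensation.Cruxes.PeriodicIRBound.LinearPhFloorWagner.WF

open Literature.MathematicalPhysics.QuantumManyBody.BoseGas

variable {M m n : ℕ} {L : ℝ}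

/-! ## Bookkeeping (private copies of the tools of part 2 and of `WFRegularity`/`WFPolar` lemmas) -/

/-- Dropping a particle keeps a configuration in the cell. [folklore] -/
private theorem removeNth_mem_cellN' {Z : Config (m + 1)} (hZ : Z ∈ cellN (m + 1) L) (j : Fin (m + 1)) :
    j.removeNth Z ∈ cellN m L := fun i => hZ (j.succAbove i)

/-- `Z ↦ tail Z` is continuous. [folklore] -/
private theorem continuous_tail' : Continuous fun Z : Config (M + 1) => Fin.tail Z :=
  continuous_pi fun i => continuous_apply i.succ

/-- The periodic pair interaction of a measurable profile is measurable. [folklore] -/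
private theorem measurable_periodicInteraction' {w : ℝ → ℝ≥0∞} (hw : Measurable w) (L : ℝ) :
    Measurable fun X : Config M => periodicInteraction w L X := by
  unfold periodicInteraction
  refine Finset.measurable_sum _ fun i _ => Finset.measurable_sum _ fun j _ => ?_
  exact measurable_periodizedPotential_pair hw L i j

/-- Integrability against a dominated weight: for a measurable weight `V` with `∫_{Λ^M} V < ∞` and an
a.e.-strongly measurable factor `B` bounded on `Λ^M`, `V.toReal · B` is integrable on `Λ^M`. [folklore] -/
private theorem integrable_toReal_mul_of_bdd' {V : Config M → ℝ≥0∞} (hV : Measurable V)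
    (hVi : ∫⁻ X in cellN M L, V X ≠ ⊤) {B : Config M → ℂ}
    (hB : AEStronglyMeasurable B ((volume : Measure (Config M)).restrict (cellN M L))) {C : ℝ}
    (hC : ∀ X ∈ cellN M L, ‖B X‖ ≤ C) :
    Integrable (fun X => ((V X).toReal : ℂ) * B X) ((volume : Measure (Config M)).restrict (cellN M L)) :=
  Integrable.mul_bdd (integrable_toReal_of_lintegral_ne_top hV.aemeasurable hVi).ofReal hB
    (ae_restrict_of_forall_mem (measurableSet_cellN M L) hC)

/-- A permutation of `Fin (m+1)` fixing `0` restricts to a permutation `e` of `Fin m`: `τ (i+1) = e(i) + 1`. [folklore] -/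
private theorem exists_perm_succ_eq' {τ : Equiv.Perm (Fin (m + 1))} (hτ : τ 0 = 0) :
    ∃ e : Equiv.Perm (Fin m), ∀ i : Fin m, τ i.succ = (e i).succ := by
  have h0 : ∀ j : Fin m, τ j.succ ≠ 0 := fun j h =>
    Fin.succ_ne_zero j (τ.injective (h.trans hτ.symm))
  have h0' : ∀ j : Fin m, τ.symm j.succ ≠ 0 := fun j h =>
    Fin.succ_ne_zero j (by rw [← τ.apply_symm_apply j.succ, h, hτ])
  refine ⟨⟨fun j => (τ j.succ).pred (h0 j), fun j => (τ.symm j.succ).pred (h0' j),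
    fun j => ?_, fun j => ?_⟩, fun j => ?_⟩
  · dsimp only
    rw [Fin.pred_eq_iff_eq_succ, Fin.succ_pred, Equiv.symm_apply_apply]
  · dsimp only
    rw [Fin.pred_eq_iff_eq_succ, Fin.succ_pred, Equiv.apply_symm_apply]
  · simp only [Equiv.coe_fn_mk, Fin.succ_pred]

/-- Dropping particle `j` after relabelling by `σ` is dropping particle `σ j` and relabelling the rest:
`removeNth j (X ∘ σ) = (removeNth (σ j) X) ∘ e`. [folklore] -/
private theorem exists_removeNth_comp_perm' {α : Type*} (σ : Equiv.Perm (Fin (m + 1))) (j : Fin (m + 1)) :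
    ∃ e : Equiv.Perm (Fin m), ∀ X : Fin (m + 1) → α,
      j.removeNth (X ∘ σ) = (σ j).removeNth X ∘ e := by
  obtain ⟨e, he⟩ := exists_perm_succ_eq' (m := m)
    (τ := (j.cycleRange.symm.trans σ).trans (σ j).cycleRange) (by simp)
  refine ⟨e, fun X => funext fun i => ?_⟩
  have hi : σ (j.succAbove i) = (σ j).succAbove (e i) := by
    rw [← Fin.cycleRange_symm_succ (σ j) (e i), ← he i]
    simp
  simp only [Fin.removeNth, Function.comp_apply, hi]

/-- `a†Φ = modeCr φ Φ` is continuous for continuous `φ`, `Φ` (copy of `WFRegularity.continuous_modeCr`). [folklore] -/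
private theorem continuous_modeCr' {φ : Space → ℂ} (hφ : Continuous φ) {n : ℕ} {Φ : Config n → ℂ}
    (hΦ : Continuous Φ) : Continuous (modeCr φ Φ) := by
  change Continuous fun X : Config (n + 1) =>
    ((Real.sqrt (n + 1) : ℝ) : ℂ)⁻¹ * ∑ j : Fin (n + 1), φ (X j) * Φ (j.removeNth X)
  exact continuous_const.mul (continuous_finsetSum _ fun j _ =>
    ((hφ.comp (continuous_apply j)).mul (hΦ.comp (continuous_removeNth j))))

/-- `(‖z‖₊²).toReal = ‖z‖²`. [folklore] -/
private theorem toReal_coe_nnnorm_sq' (z : ℂ) : (((‖z‖₊ : ℝ≥0∞)) ^ 2).toReal = ‖z‖ ^ 2 := by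
  rw [coe_nnnorm_sq_eq_ofReal, ENNReal.toReal_ofReal (sq_nonneg _)]

/-- The potential density `W |g|²` is measurable. [folklore] -/
private theorem measurable_potDensity' {w : ℝ → ℝ≥0∞} (hw : Measurable w) (L : ℝ) {g : Config M → ℂ}
    (hg : Continuous g) :
    Measurable fun X : Config M => periodicInteraction w L X * ((‖g X‖₊ : ℝ≥0∞)) ^ 2 :=
  (measurable_periodicInteraction' hw L).mul (hg.measurable.nnnorm.coe_nnreal_ennreal.pow_const _)

/-- `∫ W.toReal |g|² = P_w(g).toReal` when `P_w(g) < ∞` (copy of `WFPolar.integral_potReal`). [folklore] -/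
private theorem integral_potReal' {w : ℝ → ℝ≥0∞} (hw : Measurable w) {g : Config M → ℂ} (hg : Continuous g)
    (hP : potForm w L g ≠ ⊤) :
    ∫ X in cellN M L, (periodicInteraction w L X).toReal * ‖g X‖ ^ 2 = (potForm w L g).toReal := by
  rw [potForm, ← integral_toReal (measurable_potDensity' hw L hg).aemeasurable
    (ae_lt_top (measurable_potDensity' hw L hg) hP)]
  refine integral_congr_ae (Eventually.of_forall fun X => ?_)
  simp only [ENNReal.toReal_mul, toReal_coe_nnnorm_sq']

/-! ## The terms of `a†Φ` and the pair integrals -/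

/-- The `j`-th term of `√(m+2) · a†(φ)Φ`: `c_j(Z) = φ(Z j) Φ(Z without j)`. -/
def crTerm (L : ℝ) (k : Fin 3 → ℤ) (Φ : Config (m + 1) → ℂ) (j : Fin (m + 2)) (Z : Config (m + 2)) : ℂ :=
  planeWaveMode L k (Z j) * Φ (j.removeNth Z)

/-- The pair integrals `R_{jl} = ∫_{Λ^{m+2}} W.toReal conj(c_j) c_l`. -/
def pairInt (w : ℝ → ℝ≥0∞) (L : ℝ) (k : Fin 3 → ℤ) (Φ : Config (m + 1) → ℂ) (j l : Fin (m + 2)) : ℂ :=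
  ∫ Z in cellN (m + 2) L, ((periodicInteraction w L Z).toReal : ℂ) * (conj (crTerm L k Φ j Z) * crTerm L k Φ l Z)

/-- `c_j` is continuous. [folklore] -/
theorem continuous_crTerm (L : ℝ) (k : Fin 3 → ℤ) {Φ : Config (m + 1) → ℂ} (hΦ : Continuous Φ) (j : Fin (m + 2)) :
    Continuous (crTerm L k Φ j) :=
  ((continuous_planeWaveMode L k).comp (continuous_apply j)).mul (hΦ.comp (continuous_removeNth j))

/-- `|c_j| ≤ L^{-3/2} ‖Φ‖_∞` on `Λ^{m+2}`. [folklore] -/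
theorem norm_crTerm_le {k : Fin 3 → ℤ} {Φ : Config (m + 1) → ℂ} {C : ℝ} (hC : ∀ X ∈ cellN (m + 1) L, ‖Φ X‖ ≤ C)
    {Z : Config (m + 2)} (hZ : Z ∈ cellN (m + 2) L) (j : Fin (m + 2)) :
    ‖crTerm L k Φ j Z‖ ≤ (Real.sqrt (L ^ 3))⁻¹ * C := by
  unfold crTerm
  rw [norm_mul, norm_planeWaveMode]
  have h := hC _ (removeNth_mem_cellN' hZ j)
  gcongr

/-- The pair integrands `W.toReal conj(c_j) c_l` are integrable on `Λ^{m+2}` (integrable `w`). [folklore] -/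
theorem integrable_pairTerm (hL : 0 < L) {w : ℝ → ℝ≥0∞} (hw : Measurable w) (hint : (∫⁻ z : Space, w ‖z‖) ≠ ⊤)
    (k : Fin 3 → ℤ) {Φ : Config (m + 1) → ℂ} (hΦ : Continuous Φ) (j l : Fin (m + 2)) :
    Integrable (fun Z => ((periodicInteraction w L Z).toReal : ℂ) * (conj (crTerm L k Φ j Z) * crTerm L k Φ l Z))
      ((volume : Measure (Config (m + 2))).restrict (cellN (m + 2) L)) := by
  obtain ⟨C, hC0, hC⟩ := exists_bound_on_cellN L hΦ
  have ha : 0 ≤ (Real.sqrt (L ^ 3))⁻¹ * C := mul_nonneg (inv_nonneg.2 (Real.sqrt_nonneg _)) hC0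
  refine integrable_toReal_mul_of_bdd' (measurable_periodicInteraction' hw L)
    (lintegral_cellN_periodicInteraction_ne_top hL hw hint (m + 2))
    ((Complex.continuous_conj.comp (continuous_crTerm L k hΦ j)).mul
      (continuous_crTerm L k hΦ l)).aestronglyMeasurable
    (C := (Real.sqrt (L ^ 3))⁻¹ * C * ((Real.sqrt (L ^ 3))⁻¹ * C)) (fun Z hZ => ?_)
  rw [norm_mul, Complex.norm_conj]
  exact mul_le_mul (norm_crTerm_le hC hZ j) (norm_crTerm_le hC hZ l) (norm_nonneg _) ha

/-! ## Step (1): expansion of `|a†Φ|²` -/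

/-- **Step (1)**: `P[a†Φ].toReal = (m+2)⁻¹ Re ∑_{j,l} R_{jl}` (`|∑_j c_j|² = Re ∑_{j,l} conj(c_j) c_l`). -/
theorem toReal_potForm_modeCr_eq_sum (hL : 0 < L) {w : ℝ → ℝ≥0∞} (hw : Measurable w)
    (hint : (∫⁻ z : Space, w ‖z‖) ≠ ⊤) (k : Fin 3 → ℤ) {Φ : Config (m + 1) → ℂ} (hΦ : IsCore L Φ)
    (hP : potForm w L Φ ≠ ⊤) :
    (potForm w L (modeCr (planeWaveMode L k) Φ)).toReal =
      ((m : ℝ) + 2)⁻¹ * (∑ j : Fin (m + 2), ∑ l : Fin (m + 2), pairInt w L k Φ j l).re := by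
  have hΦc := hΦ.contDiff.continuous
  have hcont : Continuous (modeCr (planeWaveMode L k) Φ) := continuous_modeCr' (continuous_planeWaveMode L k) hΦc
  have hfin := (potForm_modeAn_ne_top_and hL hw hint k hΦ hP).2
  have hterm := integrable_pairTerm hL hw hint k hΦc
  have hsum : Integrable (fun Z : Config (m + 2) => ∑ j : Fin (m + 2), ∑ l : Fin (m + 2),
      ((periodicInteraction w L Z).toReal : ℂ) * (conj (crTerm L k Φ j Z) * crTerm L k Φ l Z))
      ((volume : Measure (Config (m + 2))).restrict (cellN (m + 2) L)) :=
    integrable_finsetSum _ fun j _ => integrable_finsetSum _ fun l _ => hterm j l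
  -- the pointwise expansion
  have key : ∀ z : ℂ, ‖z‖ ^ 2 = (conj z * z).re := fun z => by
    rw [Complex.conj_mul', ← Complex.ofReal_pow, Complex.ofReal_re]
  have hc : (Real.sqrt ((m + 1 : ℕ) + 1)) ^ 2 = (m : ℝ) + 2 := by
    rw [Real.sq_sqrt (by positivity)]
    push_cast
    ring
  have hG : ∀ Z : Config (m + 2), ((periodicInteraction w L Z).toReal : ℂ) *
      (∑ j : Fin (m + 2), ∑ l : Fin (m + 2), conj (crTerm L k Φ j Z) * crTerm L k Φ l Z) =
      ∑ j : Fin (m + 2), ∑ l : Fin (m + 2),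
        ((periodicInteraction w L Z).toReal : ℂ) * (conj (crTerm L k Φ j Z) * crTerm L k Φ l Z) := fun Z => by
    rw [Finset.mul_sum]
    exact Finset.sum_congr rfl fun j _ => by rw [Finset.mul_sum]
  have hpt : ∀ Z : Config (m + 2), (periodicInteraction w L Z).toReal * ‖modeCr (planeWaveMode L k) Φ Z‖ ^ 2 =
      ((m : ℝ) + 2)⁻¹ * RCLike.re (∑ j : Fin (m + 2), ∑ l : Fin (m + 2),
        ((periodicInteraction w L Z).toReal : ℂ) * (conj (crTerm L k Φ j Z) * crTerm L k Φ l Z)) := by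
    intro Z
    rw [← hG Z, RCLike.re_to_complex, Complex.re_ofReal_mul, modeCr_apply, norm_mul, mul_pow, norm_inv,
      Complex.norm_real, Real.norm_of_nonneg (Real.sqrt_nonneg _), inv_pow, hc, key, map_sum,
      Finset.sum_mul_sum]
    simp only [crTerm]
    ring
  rw [← integral_potReal' hw hcont hfin]
  calc ∫ Z in cellN (m + 1 + 1) L, (periodicInteraction w L Z).toReal * ‖modeCr (planeWaveMode L k) Φ Z‖ ^ 2
      = ∫ Z in cellN (m + 2) L, ((m : ℝ) + 2)⁻¹ * RCLike.re (∑ j : Fin (m + 2), ∑ l : Fin (m + 2),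
          ((periodicInteraction w L Z).toReal : ℂ) * (conj (crTerm L k Φ j Z) * crTerm L k Φ l Z)) :=
        integral_congr_ae (Eventually.of_forall hpt)
    _ = ((m : ℝ) + 2)⁻¹ * RCLike.re (∫ Z in cellN (m + 2) L, ∑ j : Fin (m + 2), ∑ l : Fin (m + 2),
          ((periodicInteraction w L Z).toReal : ℂ) * (conj (crTerm L k Φ j Z) * crTerm L k Φ l Z)) := by
        rw [integral_const_mul, integral_re hsum]
    _ = ((m : ℝ) + 2)⁻¹ * (∑ j : Fin (m + 2), ∑ l : Fin (m + 2), pairInt w L k Φ j l).re := by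
        rw [RCLike.re_to_complex, integral_finsetSum _ (fun j _ => integrable_finsetSum _ fun l _ => hterm j l)]
        congr 1
        congr 1
        refine Finset.sum_congr rfl fun j _ => ?_
        rw [integral_finsetSum _ (fun l _ => hterm j l)]
        rfl

/-! ## Step (2): relabelling symmetry and counting -/

/-- `c_j(Z ∘ σ) = c_{σ j}(Z)` for Bose-symmetric `Φ`. [folklore] -/
theorem crTerm_comp_perm {k : Fin 3 → ℤ} {Φ : Config (m + 1) → ℂ} (hΦ : IsSymm Φ) (σ : Equiv.Perm (Fin (m + 2)))
    (j : Fin (m + 2)) (Z : Config (m + 2)) :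
    crTerm L k Φ j (Z ∘ σ) = crTerm L k Φ (σ j) Z := by
  obtain ⟨e, he⟩ := exists_removeNth_comp_perm' (α := Space) σ j
  unfold crTerm
  rw [Function.comp_apply, he Z, hΦ]

/-- **Relabelling symmetry of the pair integrals**: `R_{σj, σl} = R_{jl}` (TK2, `periodicInteraction_comp_perm`,
Bose symmetry of `Φ`). -/
theorem pairInt_perm {w : ℝ → ℝ≥0∞} {k : Fin 3 → ℤ} {Φ : Config (m + 1) → ℂ} (hΦ : IsSymm Φ)
    (σ : Equiv.Perm (Fin (m + 2))) (j l : Fin (m + 2)) :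
    pairInt w L k Φ (σ j) (σ l) = pairInt w L k Φ j l := by
  unfold pairInt
  rw [← integral_cellN_comp_perm L σ (fun Z => ((periodicInteraction w L Z).toReal : ℂ) *
    (conj (crTerm L k Φ j Z) * crTerm L k Φ l Z))]
  refine integral_congr_ae (Eventually.of_forall fun Z => ?_)
  simp only [periodicInteraction_comp_perm, crTerm_comp_perm hΦ]

/-- The diagonal pair integrals are all `R_{00}`. -/
theorem pairInt_diag {w : ℝ → ℝ≥0∞} {k : Fin 3 → ℤ} {Φ : Config (m + 1) → ℂ} (hΦ : IsSymm Φ) (j : Fin (m + 2)) :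
    pairInt w L k Φ j j = pairInt w L k Φ 0 0 := by
  have h := pairInt_perm (w := w) (L := L) (k := k) hΦ (Equiv.swap 0 j) 0 0
  rwa [Equiv.swap_apply_left] at h

/-- The off-diagonal pair integrals are all `R_{10}` (a permutation with `σ 1 = j`, `σ 0 = l`). -/
theorem pairInt_offDiag {w : ℝ → ℝ≥0∞} {k : Fin 3 → ℤ} {Φ : Config (m + 1) → ℂ} (hΦ : IsSymm Φ)
    {j l : Fin (m + 2)} (hjl : j ≠ l) : pairInt w L k Φ j l = pairInt w L k Φ 1 0 := by
  set σ : Equiv.Perm (Fin (m + 2)) := Equiv.swap 0 l * Equiv.swap 1 (Equiv.swap 0 l j) with hσ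
  have hj' : Equiv.swap 0 l j ≠ 0 := by
    intro h
    rw [Equiv.swap_apply_eq_iff, Equiv.swap_apply_left] at h
    exact hjl h
  have h0 : σ 0 = l := by
    rw [hσ, Equiv.Perm.mul_apply, Equiv.swap_apply_of_ne_of_ne (Fin.zero_ne_one' (n := m + 1)) hj'.symm,
      Equiv.swap_apply_left]
  have h1 : σ 1 = j := by
    rw [hσ, Equiv.Perm.mul_apply, Equiv.swap_apply_left, Equiv.swap_apply_self]
  have h := pairInt_perm (w := w) (L := L) (k := k) hΦ σ 1 0
  rw [h0, h1] at h
  exact h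

/-- **Counting**: `∑_{j,l} R_{jl} = (m+2)(R_{00} + (m+1) R_{10})` (`m+2` diagonal terms, `(m+2)(m+1)` ordered pairs). -/
theorem sum_sum_pairInt {w : ℝ → ℝ≥0∞} {k : Fin 3 → ℤ} {Φ : Config (m + 1) → ℂ} (hΦ : IsSymm Φ) :
    ∑ j : Fin (m + 2), ∑ l : Fin (m + 2), pairInt w L k Φ j l =
      (((m : ℝ) + 2 : ℝ) : ℂ) * (pairInt w L k Φ 0 0 + (((m : ℝ) + 1 : ℝ) : ℂ) * pairInt w L k Φ 1 0) := by
  have hjl : ∀ j l : Fin (m + 2), pairInt w L k Φ j l =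
      pairInt w L k Φ 1 0 + if l = j then pairInt w L k Φ 0 0 - pairInt w L k Φ 1 0 else 0 := by
    intro j l
    by_cases h : l = j
    · rw [if_pos h, h, pairInt_diag hΦ]
      ring
    · rw [if_neg h, pairInt_offDiag hΦ (Ne.symm h)]
      ring
  rw [Finset.sum_congr rfl fun j _ => Finset.sum_congr rfl fun l _ => hjl j l]
  simp only [Finset.sum_add_distrib, Finset.sum_const, Finset.card_univ, Fintype.card_fin, Finset.sum_ite_eq',
    Finset.mem_univ, if_true, nsmul_eq_mul]
  push_cast
  ring

/-! ## Step (3a): the direct term as an `ℝ≥0∞` integral, and the reduction -/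

/-- **Step (3a)**: `Re R_{00} = (∫_{Λ^{m+2}} W |φ(Z 0)|² |Φ(tail Z)|²).toReal` (the integrand is finite a.e. since
`W < ∞` a.e.; this is the left-hand side of P-dir). -/
theorem re_pairInt_zero_zero (hL : 0 < L) {w : ℝ → ℝ≥0∞} (hw : Measurable w) (hint : (∫⁻ z : Space, w ‖z‖) ≠ ⊤)
    (k : Fin 3 → ℤ) {Φ : Config (m + 1) → ℂ} (hΦ : Continuous Φ) :
    (pairInt w L k Φ 0 0).re = (∫⁻ Z in cellN (m + 2) L, periodicInteraction w L Z *
        (((‖planeWaveMode L k (Z 0)‖₊ : ℝ≥0∞)) ^ 2 * ((‖Φ (Fin.tail Z)‖₊ : ℝ≥0∞)) ^ 2)).toReal := by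
  have h1 : pairInt w L k Φ 0 0 = ((∫ Z in cellN (m + 2) L,
      (periodicInteraction w L Z).toReal * ‖crTerm L k Φ 0 Z‖ ^ 2 : ℝ) : ℂ) := by
    rw [pairInt, ← integral_complex_ofReal]
    refine integral_congr_ae (Eventually.of_forall fun Z => ?_)
    dsimp only
    rw [Complex.conj_mul']
    push_cast
    ring
  have hmeas : Measurable fun Z : Config (m + 2) => periodicInteraction w L Z *
      (((‖planeWaveMode L k (Z 0)‖₊ : ℝ≥0∞)) ^ 2 * ((‖Φ (Fin.tail Z)‖₊ : ℝ≥0∞)) ^ 2) :=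
    (measurable_periodicInteraction' hw L).mul
      ((((continuous_planeWaveMode L k).comp (continuous_apply 0)).nnnorm.measurable.coe_nnreal_ennreal.pow_const _).mul
        ((hΦ.comp continuous_tail').nnnorm.measurable.coe_nnreal_ennreal.pow_const _))
  have hae : ∀ᵐ Z ∂((volume : Measure (Config (m + 2))).restrict (cellN (m + 2) L)), periodicInteraction w L Z *
      (((‖planeWaveMode L k (Z 0)‖₊ : ℝ≥0∞)) ^ 2 * ((‖Φ (Fin.tail Z)‖₊ : ℝ≥0∞)) ^ 2) < ⊤ := by
    filter_upwards [ae_lt_top (measurable_periodicInteraction' hw L)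
      (lintegral_cellN_periodicInteraction_ne_top hL hw hint (m + 2))] with Z hZ
    exact ENNReal.mul_lt_top hZ (ENNReal.mul_lt_top (ENNReal.pow_lt_top ENNReal.coe_lt_top)
      (ENNReal.pow_lt_top ENNReal.coe_lt_top))
  rw [h1, Complex.ofReal_re, ← integral_toReal hmeas.aemeasurable hae]
  refine integral_congr_ae (Eventually.of_forall fun Z => ?_)
  simp only [crTerm, Fin.removeNth_zero, ENNReal.toReal_mul, toReal_coe_nnnorm_sq', norm_mul, mul_pow]

/-- **Part 1 of P-b** (steps (1)–(3a)): `P[a†Φ].toReal = (∫ W |φ(Z 0)|² |Φ(tail Z)|²).toReal + (m+1) Re O`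
with the exchange integral `O = R_{10} = ∫_{Λ^{m+2}} W conj(φ(Z 1) Φ(Z without 1)) φ(Z 0) Φ(Z without 0)`
(the first term is evaluated by P-dir and `O` by part 2, in part 3). -/
theorem toReal_potForm_modeCr_reduce (hL : 0 < L) {w : ℝ → ℝ≥0∞} (hw : Measurable w) (hint : (∫⁻ z : Space, w ‖z‖) ≠ ⊤)
    (k : Fin 3 → ℤ) {Φ : Config (m + 1) → ℂ} (hΦ : IsCore L Φ) (hP : potForm w L Φ ≠ ⊤) :
    (potForm w L (modeCr (planeWaveMode L k) Φ)).toReal =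
      (∫⁻ Z in cellN (m + 2) L, periodicInteraction w L Z *
          (((‖planeWaveMode L k (Z 0)‖₊ : ℝ≥0∞)) ^ 2 * ((‖Φ (Fin.tail Z)‖₊ : ℝ≥0∞)) ^ 2)).toReal +
        (m + 1) * (∫ Z in cellN (m + 2) L, ((periodicInteraction w L Z).toReal : ℂ) *
          (conj (planeWaveMode L k (Z 1) * Φ (Fin.removeNth 1 Z)) *
            (planeWaveMode L k (Z 0) * Φ (Fin.removeNth 0 Z)))).re := by
  have hO : (∫ Z in cellN (m + 2) L, ((periodicInteraction w L Z).toReal : ℂ) *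
      (conj (planeWaveMode L k (Z 1) * Φ (Fin.removeNth 1 Z)) * (planeWaveMode L k (Z 0) * Φ (Fin.removeNth 0 Z)))) =
      pairInt w L k Φ 1 0 := rfl
  rw [hO, toReal_potForm_modeCr_eq_sum hL hw hint k hΦ hP, sum_sum_pairInt hΦ.symm,
    ← re_pairInt_zero_zero hL hw hint k hΦ.contDiff.continuous, Complex.re_ofReal_mul, Complex.add_re,
    Complex.re_ofReal_mul]
  have hm : (m : ℝ) + 2 ≠ 0 := by positivity
  rw [← mul_assoc, inv_mul_cancel₀ hm, one_mul]

end Summit.AtomisticToContinuum.BoseEinsteinCondensation.Cruxes.PeriodicIRBound.LinearPhFloorWagner.WF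

end

namespace Summit.AtomisticToContinuum.BoseEinsteinCondensation.Cruxes.PeriodicIRBound.LinearPhFloorWagner

/-- The registered sub-goal `stub_wfPotCreate` of the crux ledger: this file's headline lemma `WF.toReal_potForm_modeCr_reduce`. -/
theorem stub_wfPotCreate : WF.Pkg.PotCreate :=
  @WF.toReal_potForm_modeCr_reduce

end Summit.AtomisticToContinuum.BoseEinsteinCondensation.Cruxes.PeriodicIRBound.LinearPhFloorWagner
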